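import Literature.AlgebraicGeometry.Pohlmann1968.SimpleCMAbelianVarietyHazamaCriterion
import Literature.AlgebraicGeometry.Motives.HodgeStructureDirectSum
import HarnessLib

/-!
# Künneth in degree one as an isomorphism of `ℚ`-Hodge structures: `H¹(⨁_j A_j) ≅ ⊕_j H¹(A_j)` for a finite
# biproduct of complex abelian varieties; the Mumford–Tate rank of `H¹` of a product

Family `hodge`, layer `Literature/AlgebraicGeometry/Motives`; KERNEL ONLY (theorems; no definition, no named fact);
UNCONDITIONAL in the two standard inputs `hHD : exists_isReal_hodgeModel`, `hI : hodgePQ_independent_of_hodgeModel`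
of `HodgeTheory/BettiUniverseAxioms` (both tree theorems: `exists_isReal_hodgeModel_holds`,
`hodgePQ_independent_of_hodgeModel_holds`).  Cell `pub-hodgecm2` (COR-CM), count-neutral, lane MT-VARIETY (sequel of
`Motives/MumfordTateRankOfCMFamily*`: those files compute `dim MT` of the ABSTRACT direct sum `⊕_i H¹(A_i)` =
`HodgeStructure.pi`; this file identifies that direct sum with `H¹` of the VARIETY `⨁_i A_i`).

## Statements

For a finite family `A : J → AbelianVariety ℂ` with biproduct `⨁ A` (projections `π_j`, coprojections `ι_j`) and the
rational Betti cohomology `H¹(−(ℂ); ℚ) = Motives.bettiCohomology − 1` with pull-backs `BettiUniverse.pull`: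

* `pull_biproduct_ι_π_self` / `pull_biproduct_ι_π_ne` / `sum_pull_biproduct_π_ι` — `ι_j^* π_j^* = id`,
  `ι_i^* π_j^* = 0` (`i ≠ j`), `Σ_j π_j^* ι_j^* = id` on `H¹(−; ℚ)` (the additive functor `H¹` on the biproduct
  identities `ι ≫ π = δ`, `Σ π ≫ ι = 𝟙`; additivity of `f ↦ f^*` on `H¹` is the tree's `bettiCohomology_map_sum_one`);
* **`bijective_sum_pull_biproduct_π`** — Künneth in degree one: `(y_j)_j ↦ Σ_j π_j^* y_j :
  Π_j H¹(A_j(ℂ); ℚ) → H¹((⨁ A)(ℂ); ℚ)` is bijective (the tree's `product_bettiMap_bijective_holds` is the case of a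
  constant family; `Pohlmann1968.exists_biproductBasis` the statement with `ℂ`-coefficients);
  `finrank_bettiCohomology_one_biproduct` — `dim_ℚ H¹(⨁ A) = Σ_j dim_ℚ H¹(A_j)`;
* **`pi_hodge_one_eq_comapEquiv_biproduct`** — the Künneth map is an ISOMORPHISM OF `ℚ`-HODGE STRUCTURES:
  `⊕_j H¹(A_j) = e^* H¹(⨁ A)` (`HodgeStructure.pi` of the `BettiUniverse.hodge`'s versus `BettiUniverse.hodge` of the
  biproduct), `e` the linear equivalence above — it is the morphism `Hom.piDesc (π_j^*)_j` of Hodge structures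
  (`BettiUniverse.pullHodgeHom`, Voisin I §7.3.2) and bijective, hence an isomorphism (strictness,
  `HodgeStructure.eq_comapEquiv_of_bijective`).  Voisin I Thm. 11.38 / 11.40: the Künneth isomorphism is compatible
  with the Hodge decomposition;
* **`mtRank_hodge_one_biproduct`** — `dim MT(H¹(⨁_j A_j)) = dim MT(⊕_j H¹(A_j))` (`HodgeStructure.mtRank_comapEquiv`),
  and `mtRank_hodge_one_eq_of_isIsogenous_biproduct` — the same for every `X` isogenous to `⨁_j A_j`.

## References

* [VoisinHodgeI2002] C. Voisin, *Hodge Theory and Complex Algebraic Geometry I*, CUP 2002, §7.3.2 and §11.3.3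
  Thm. 11.38, Thm. 11.40.
* [LangeBirkenhake1992] H. Lange, Ch. Birkenhake, *Complex Abelian Varieties*, §1.1 Lemma 1.1.17.
* [HatcherAT2002] A. Hatcher, *Algebraic Topology*, §3.2 Thm. 3.16.
* [DeligneHodgeII1971] P. Deligne, *Théorie de Hodge II*, 2.1 and Thm. 2.3.5 (iii).
* [MumfordAV1970] D. Mumford, *Abelian Varieties*, §19.
-/

noncomputable section

open CategoryTheory CategoryTheory.Limits

namespace Literature.AlgebraicGeometry.Motives

namespace AbelianVariety

open Literature.AlgebraicGeometry.HodgeTheory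
open Literature.AlgebraicGeometry.ComplexMultiplication
  (bettiCohomology_map_comp_hom bettiCohomology_map_id_hom bettiCohomology_map_zero_one bettiCohomology_map_sum_one)

/-! ### §1 Linear algebra of a biproduct with variable summands -/

/-- Linear algebra of a biproduct with summands `V_j`: families `f_j : V_j → W`, `g_j : W → V_j` with
`g_j ∘ f_j = id`, `g_i ∘ f_j = 0` (`i ≠ j`) and `∑_j f_j ∘ g_j = id` make `v ↦ ∑_j f_j (v_j) : Π_j V_j → W`
bijective (the tree's `bijective_sum_comp_proj` is the case of a constant family). [folklore] -/
private theorem bijective_sum_comp_proj_pi {R ι W : Type*} {V : ι → Type*} [Semiring R] [Fintype ι]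
    [∀ i, AddCommMonoid (V i)] [∀ i, Module R (V i)] [AddCommMonoid W] [Module R W]
    (f : ∀ i, V i →ₗ[R] W) (g : ∀ i, W →ₗ[R] V i)
    (hself : ∀ i (x : V i), g i (f i x) = x) (hne : ∀ i j, i ≠ j → ∀ x : V j, g i (f j x) = 0)
    (hfg : ∀ w : W, ∑ j, f j (g j w) = w) :
    Function.Bijective (∑ j, f j ∘ₗ LinearMap.proj j : (∀ i, V i) →ₗ[R] W) := by
  have happ : ∀ v : ∀ i, V i, (∑ j, f j ∘ₗ LinearMap.proj j : (∀ i, V i) →ₗ[R] W) v = ∑ j, f j (v j) :=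
    fun v => by rw [LinearMap.sum_apply]; rfl
  have hleft : ∀ (v : ∀ i, V i) (i : ι), g i ((∑ j, f j ∘ₗ LinearMap.proj j : (∀ i, V i) →ₗ[R] W) v) = v i :=
    fun v i => by
      rw [happ, map_sum, Finset.sum_eq_single i (fun j _ hji => hne i j (Ne.symm hji) (v j))
        (fun h => (h (Finset.mem_univ i)).elim), hself]
  refine ⟨fun v v' h => funext fun i => ?_, fun w => ⟨fun j => g j w, by rw [happ, hfg]⟩⟩
  rw [← hleft v i, ← hleft v' i, h]

/-! ### §2 `H¹(⨁_j A_j; ℚ) = ⊕_j π_j^* H¹(A_j; ℚ)` (Künneth in degree one, rational coefficients) -/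

variable {J : Type} [Fintype J] (A : J → AbelianVariety ℂ)

/-- `ι_j^* π_j^* = id` on `H¹(A_j(ℂ); ℚ)` (`ι_j ≫ π_j = 𝟙`). [cite: HatcherAT2002, §3.2 Thm. 3.16] -/
theorem pull_biproduct_ι_π_self (j : J) (x : bettiCohomology (A j).X 1) :
    BettiUniverse.pull (biproduct.ι A j).hom.hom.hom 1 (BettiUniverse.pull (biproduct.π A j).hom.hom.hom 1 x) = x := by
  have h := bettiCohomology_map_comp_hom (biproduct.ι A j) (biproduct.π A j) 1
  rw [biproduct.ι_π_self, bettiCohomology_map_id_hom] at h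
  have e := congrArg (fun φ => ModuleCat.Hom.hom φ x) h
  dsimp only at e
  rw [ModuleCat.hom_comp, LinearMap.comp_apply] at e
  exact e.symm

/-- `ι_i^* π_j^* = 0` on `H¹(A_j(ℂ); ℚ)` for `i ≠ j` (`ι_i ≫ π_j = 0` and `0^* = 0` on `H¹`,
`bettiCohomology_map_zero_one`). [cite: HatcherAT2002, §3.2 Thm. 3.16] -/
theorem pull_biproduct_ι_π_ne {i j : J} (hij : i ≠ j) (x : bettiCohomology (A j).X 1) :
    BettiUniverse.pull (biproduct.ι A i).hom.hom.hom 1 (BettiUniverse.pull (biproduct.π A j).hom.hom.hom 1 x) = 0 := by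
  have h := bettiCohomology_map_comp_hom (biproduct.ι A i) (biproduct.π A j) 1
  rw [biproduct.ι_π_ne A hij, bettiCohomology_map_zero_one] at h
  have e := congrArg (fun φ => ModuleCat.Hom.hom φ x) h
  dsimp only at e
  rw [ModuleCat.hom_comp, LinearMap.comp_apply] at e
  exact e.symm

/-- **`x = Σ_j π_j^* ι_j^* x` on `H¹((⨁ A)(ℂ); ℚ)`** (pull back `𝟙 = Σ_j π_j ≫ ι_j`, `biproduct.total`, along the
additive functor `H¹(−(ℂ); ℚ)`, `bettiCohomology_map_sum_one`). [cite: HatcherAT2002, §3.2 Thm. 3.16]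
[cite: LangeBirkenhake1992, §1.1 Lemma 1.1.17] -/
theorem sum_pull_biproduct_π_ι (x : bettiCohomology (⨁ A).X 1) :
    ∑ j, BettiUniverse.pull (biproduct.π A j).hom.hom.hom 1
      (BettiUniverse.pull (biproduct.ι A j).hom.hom.hom 1 x) = x := by
  have h := bettiCohomology_map_sum_one Finset.univ (fun j => biproduct.π A j ≫ biproduct.ι A j)
  rw [biproduct.total, bettiCohomology_map_id_hom] at h
  have e := congrArg (fun φ => ModuleCat.Hom.hom φ x) h
  dsimp only at e
  rw [ModuleCat.hom_sum, LinearMap.sum_apply] at e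
  rw [ModuleCat.hom_id, LinearMap.id_apply] at e
  refine Eq.trans (Finset.sum_congr rfl fun j _ => ?_) e.symm
  rw [bettiCohomology_map_comp_hom, ModuleCat.hom_comp, LinearMap.comp_apply]

/-- **Künneth in degree one for a finite biproduct of complex abelian varieties, rational coefficients**:
`(y_j)_j ↦ Σ_j π_j^* y_j : Π_j H¹(A_j(ℂ); ℚ) → H¹((⨁_j A_j)(ℂ); ℚ)` is bijective, with inverse `x ↦ (ι_j^* x)_j`.
[cite: VoisinHodgeI2002, §11.3.3 Thm. 11.38] [cite: LangeBirkenhake1992, §1.1 Lemma 1.1.17]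
[cite: HatcherAT2002, §3.2 Thm. 3.16] -/
theorem bijective_sum_pull_biproduct_π :
    Function.Bijective (∑ j, BettiUniverse.pull (biproduct.π A j).hom.hom.hom 1 ∘ₗ LinearMap.proj j :
      (∀ j, bettiCohomology (A j).X 1) →ₗ[ℚ] bettiCohomology (⨁ A).X 1) :=
  bijective_sum_comp_proj_pi (fun j => BettiUniverse.pull (biproduct.π A j).hom.hom.hom 1)
    (fun j => BettiUniverse.pull (biproduct.ι A j).hom.hom.hom 1) (pull_biproduct_ι_π_self A)
    (fun _ _ hij => pull_biproduct_ι_π_ne A hij) (sum_pull_biproduct_π_ι A)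

/-- **`dim_ℚ H¹((⨁_j A_j)(ℂ); ℚ) = Σ_j dim_ℚ H¹(A_j(ℂ); ℚ)`.** [cite: VoisinHodgeI2002, §11.3.3 Thm. 11.38]
[cite: LangeBirkenhake1992, §1.1 Lemma 1.1.17] -/
theorem finrank_bettiCohomology_one_biproduct :
    Module.finrank ℚ (bettiCohomology (⨁ A).X 1) = ∑ j, Module.finrank ℚ (bettiCohomology (A j).X 1) := by
  haveI : ∀ j, Module.Finite ℚ (bettiCohomology (A j).X 1) := fun j =>
    BettiUniverse.finite (AbelianVariety.isSmoothProjective_holds (A := A j)) 1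
  rw [← (LinearEquiv.ofBijective _ (bijective_sum_pull_biproduct_π A)).finrank_eq, Module.finrank_pi_fintype]

/-! ### §3 The Künneth map is an isomorphism of `ℚ`-Hodge structures -/

variable [DecidableEq J] {A} {n : J → ℕ} {m : ℕ} (hA : ∀ j, IsSmoothProjective (n j) (A j).X)
  (hB : IsSmoothProjective m (⨁ A).X)

/-- The linear map underlying the morphism of Hodge structures `⊕_j H¹(A_j) → H¹(⨁ A)` assembled from the
pull-backs `π_j^*` (`Hom.piDesc` of the `BettiUniverse.pullHodgeHom`) is the Künneth map `(y_j) ↦ Σ_j π_j^* y_j`.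
[cite: VoisinHodgeI2002, §7.3.2] -/
theorem piDesc_pullHodgeHom_biproduct_π_toLinearMap (hHD : exists_isReal_hodgeModel)
    (hI : hodgePQ_independent_of_hodgeModel) :
    (HodgeStructure.Hom.piDesc fun j =>
        BettiUniverse.pullHodgeHom hHD hI hB (hA j) (biproduct.π A j).hom.hom.hom 1).toLinearMap =
      ∑ j, BettiUniverse.pull (biproduct.π A j).hom.hom.hom 1 ∘ₗ LinearMap.proj j :=
  rfl

/-- **Künneth in degree one is an isomorphism of `ℚ`-Hodge structures**: for a finite biproduct `⨁_j A_j` of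
complex abelian varieties, the direct sum `⊕_j H¹(A_j(ℂ); ℚ)` of the Hodge structures of the factors
(`HodgeStructure.pi`) is the transport `e^* H¹((⨁ A)(ℂ); ℚ)` of the Hodge structure of the biproduct along the
Künneth equivalence `e : (y_j)_j ↦ Σ_j π_j^* y_j` — `Σ_j π_j^* ∘ pr_j` is a morphism of Hodge structures
(`pullHodgeHom`, `Hom.piDesc`) with bijective underlying map, hence an isomorphism
(`HodgeStructure.eq_comapEquiv_of_bijective`, strictness of morphisms).  Voisin I Thm. 11.40 in degree `(1, 0) + (0, 1)`:
«`H^k(X) ⊗ H^l(Y)` is a sub-Hodge structure of `H^{k+l}(X × Y)`», here `k + l = 1`, where the two summands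
`H¹(X) ⊗ H⁰(Y)`, `H⁰(X) ⊗ H¹(Y)` exhaust `H¹(X × Y)`. [cite: VoisinHodgeI2002, §11.3.3 Thm. 11.38 and Thm. 11.40, §7.3.2]
[cite: DeligneHodgeII1971, 2.1 and Thm. 2.3.5 (iii)] -/
theorem pi_hodge_one_eq_comapEquiv_biproduct (hHD : exists_isReal_hodgeModel)
    (hI : hodgePQ_independent_of_hodgeModel) :
    HodgeStructure.pi (fun j => BettiUniverse.hodge hHD (hA j) 1) =
      (BettiUniverse.hodge hHD hB 1).comapEquiv
        (LinearEquiv.ofBijective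
          (∑ j, BettiUniverse.pull (biproduct.π A j).hom.hom.hom 1 ∘ₗ LinearMap.proj j :
            (∀ j, bettiCohomology (A j).X 1) →ₗ[ℚ] bettiCohomology (⨁ A).X 1)
          (bijective_sum_pull_biproduct_π A)) :=
  HodgeStructure.eq_comapEquiv_of_bijective
    (HodgeStructure.Hom.piDesc fun j =>
      BettiUniverse.pullHodgeHom hHD hI hB (hA j) (biproduct.π A j).hom.hom.hom 1)
    (bijective_sum_pull_biproduct_π A)

/-- **The Hodge classes of `H¹` of a biproduct, componentwise**: `(y_j)_j ∈ Hdg(⊕_j H¹(A_j))` iff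
`Σ_j π_j^* y_j ∈ Hdg(H¹(⨁ A))` — vacuous in odd weight, recorded as the shape of the transport for later even-degree
use. [cite: DeligneHodgeII1971, 2.1] -/
theorem mem_hodgeClasses_pi_hodge_one_iff (hHD : exists_isReal_hodgeModel)
    (hI : hodgePQ_independent_of_hodgeModel) (p : ℤ) (y : ∀ j, bettiCohomology (A j).X 1) :
    y ∈ (HodgeStructure.pi fun j => BettiUniverse.hodge hHD (hA j) 1).hodgeClasses p ↔
      (∑ j, BettiUniverse.pull (biproduct.π A j).hom.hom.hom 1 (y j)) ∈
        (BettiUniverse.hodge hHD hB 1).hodgeClasses p := by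
  rw [pi_hodge_one_eq_comapEquiv_biproduct hA hB hHD hI, HodgeStructure.mem_hodgeClasses_iff,
    HodgeStructure.mem_hodgeClasses_iff, HodgeStructure.comapEquiv_F, Submodule.mem_comap,
    HodgeStructure.baseChange_ofRat]
  have happ : (LinearEquiv.ofBijective
      (∑ j, BettiUniverse.pull (biproduct.π A j).hom.hom.hom 1 ∘ₗ LinearMap.proj j :
        (∀ j, bettiCohomology (A j).X 1) →ₗ[ℚ] bettiCohomology (⨁ A).X 1)
      (bijective_sum_pull_biproduct_π A)).toLinearMap y =
      ∑ j, BettiUniverse.pull (biproduct.π A j).hom.hom.hom 1 (y j) := by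
    rw [LinearEquiv.coe_coe, LinearEquiv.ofBijective_apply, LinearMap.sum_apply]
    rfl
  rw [happ]

variable [HodgeTensorFacts.{0, 0}]

/-- **`dim MT(H¹(⨁_j A_j)) = dim MT(⊕_j H¹(A_j))`**: the Mumford–Tate rank of `H¹` of a finite biproduct of complex
abelian varieties is that of the direct sum of the Hodge structures `H¹(A_j)` (`pi_hodge_one_eq_comapEquiv_biproduct` and
the isomorphism invariance `HodgeStructure.mtRank_comapEquiv`) — the bridge from the tree's Mumford–Tate computations
on `HodgeStructure.pi` (`mtRank_pi_bettiHodge_eq_cmFamilyRank`, `CorCM/MumfordTateRankOfCMProducts`) to the VARIETY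
`∏_j A_j`. [cite: VoisinHodgeI2002, §11.3.3 Thm. 11.38 and Thm. 11.40] [cite: BaldiKlinglerUllmo2024, §3.2] -/
theorem mtRank_hodge_one_biproduct (hHD : exists_isReal_hodgeModel) (hI : hodgePQ_independent_of_hodgeModel) :
    haveI := BettiUniverse.finite hB 1
    haveI : ∀ j, Module.Finite ℚ (bettiCohomology (A j).X 1) := fun j => BettiUniverse.finite (hA j) 1
    (BettiUniverse.hodge hHD hB 1).mtRank =
      (HodgeStructure.pi fun j => BettiUniverse.hodge hHD (hA j) 1).mtRank := by
  haveI := BettiUniverse.finite hB 1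
  haveI : ∀ j, Module.Finite ℚ (bettiCohomology (A j).X 1) := fun j => BettiUniverse.finite (hA j) 1
  rw [pi_hodge_one_eq_comapEquiv_biproduct hA hB hHD hI, HodgeStructure.mtRank_comapEquiv]

/-- **`dim MT(H¹(X)) = dim MT(⊕_j H¹(A_j))` for every complex abelian variety `X` isogenous to the biproduct
`⨁_j A_j`** (isogeny invariance of the Mumford–Tate rank of `H¹`, `Pohlmann1968.mtRank_hodge_one_eq_of_isIsogenous`,
and `mtRank_hodge_one_biproduct`). [cite: VoisinHodgeI2002, §7.3.2 and §11.3.3 Thm. 11.40] -/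
theorem mtRank_hodge_one_eq_of_isIsogenous_biproduct (hHD : exists_isReal_hodgeModel)
    (hI : hodgePQ_independent_of_hodgeModel) {X : AbelianVariety ℂ} {k : ℕ} (hX : IsSmoothProjective k X.X)
    (hXB : IsIsogenous X (⨁ A)) :
    haveI := BettiUniverse.finite hX 1
    haveI : ∀ j, Module.Finite ℚ (bettiCohomology (A j).X 1) := fun j => BettiUniverse.finite (hA j) 1
    (BettiUniverse.hodge hHD hX 1).mtRank =
      (HodgeStructure.pi fun j => BettiUniverse.hodge hHD (hA j) 1).mtRank := by
  have hB' : IsSmoothProjective (⨁ A).dim (⨁ A).X := AbelianVariety.isSmoothProjective_holds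
  haveI := BettiUniverse.finite hX 1
  haveI := BettiUniverse.finite hB' 1
  haveI : ∀ j, Module.Finite ℚ (bettiCohomology (A j).X 1) := fun j => BettiUniverse.finite (hA j) 1
  exact (Pohlmann1968.mtRank_hodge_one_eq_of_isIsogenous hX hB' hXB).trans
    (mtRank_hodge_one_biproduct hA hB' hHD hI)

end AbelianVariety

end Literature.AlgebraicGeometry.Motives

end
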